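import Summits.QuantumFields.YangMills.Theorems.PoincareLipschitzLeungXinBoxCaccioppoli
import HarnessLib

/-!
# Crux `HistoryTailL` (stmt-QuantumFields-19936), K2 organ of record `hImproveCore` ∕ `hImproveCoreFlat` (LEAD ★w1-19936 g9, FROZEN v1
# 7446c95a ∕ bac8eda3): LETTERS FOR THE LOG-CUTOFF STABILITY CAP — sup-norm shells of `ℤ³`, the face count `6(2k+1)²`, and the
# Hardy-optimal LOG PROFILE `η = (r∕‖y−z‖_∞)^{1∕2}` (plateau ∕ log decay ∕ linear taper), def-free as an existence statement

Cell `ym3-torus` (YM ladder rung R3 = continuum SU(2) Yang–Mills on the three-torus — a RUNG, NOT the Clay problem: not d = 4, not infinite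
volume, not a mass gap), WIDTH seat `ym-ust-19936-w3` gen 14; `--supports stmt-QuantumFields-19936 --as helper`; THEOREMS ONLY, definition-free.
Imports ✓`…LeungXinBoxCaccioppoli` (for the `Zd d` ∕ `box` letters) only.

WHY.  The continuum Schoen–Uhlenbeck stability test for minimising maps `B³ → S³` integrates the second-variation inequality
`∫|∇u|²φ² ≤ 3∫|∇φ|²` (✓`graph_stability` ∕ ✓`twisted_graph_stability_eps` on the lattice, constant `k∕(k−2) = 3`) against the HARDY-OPTIMAL radial
weight `φ = |x|^{−1∕2}`, whose capacity is `π·log(R∕r)` — so the LOG-AVERAGED normalised energy is capped at `3π` ([SchoenUhlenbeck1984] §2;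
★w8-19936 g6 05:12:47Z located it for this cell; ★w3 g13 BLUEPRINT §2 (S)).  On `ℤ³` the natural shells are SUP-NORM cubes: this file supplies the
finite-sum letters of that test — (§1) a shell index `N` with `y ∈ Q_k(z) ↔ N y ≤ k`, its unit-step Lipschitz property, and the count of lattice
bonds crossing the shell `k ↔ k+1` (`≤ 6(2k+1)²`: direction × orientation × two transverse coordinates, an explicit injection); (§2) the profile
`f` (`≡ 1` on `[0,r]`, `√(r∕n)` on `[r,M]`, linear taper to `0` on `[M,2M]`) with the EXACT telescoping `f(k)² − f(k+1)² = r∕k − r∕(k+1)` and the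
Hardy increments `(f(k) − f(k+1))² ≤ r∕(4k²(k+1))` (log range), `= r∕M³` (taper).  Consumed by `…LogCutoffCapacity` (capacity `6r(H+2) + 96r`,
Abel summation) and `…LogCutoffStabilityCap` (one good scale per window ⇒ the organ's `∀Λ₀` is removable).

WHAT (ns `…Theorems.PoincareLipschitzLogCutoffLetters`).
* §1 `exists_supIndex`, `supIndex_step`, `coord_eq_of_mem_of_add_not_mem`, `coord_eq_of_not_mem_of_add_mem`, `abs_coord_le_of_crossing`,
  ★`card_crossing_le`.
* §2 `sq_sub_le_of_sq`, ★`exists_logProfile`.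
HONEST SCOPE.  Lattice bookkeeping and one-variable real analysis; nothing of `hImproveCore(Flat)`, `hImprove`, K1-exp, `MeanDeviationL`,
`BlockLipschitzL`, `HistoryTailL` or any summit statement is proved.  YM₃ on T³ is rung R3, NOT the Clay problem.

References: R. Schoen, K. Uhlenbeck, Invent. Math. **78** (1984) 89–100 [SchoenUhlenbeck1984] (§2: the log-cutoff ∕ tangent-map test at `d(3) = 3`);
Y. L. Xin, Duke Math. J. **47** (1980) 609–613 [Xin1980]; M. Giaquinta [Giaquinta1984] Ch. III §1 (boxes).
-/

set_option autoImplicit false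

open scoped BigOperators
open Finset Matrix

namespace Summit.QuantumFields.YangMills.Theorems.PoincareLipschitzLogCutoffLetters

open Literature.MathematicalPhysics.QuantumFieldTheory.Balaban1983to89.B4Eq19LatticeOperators
  (Zd unitVec box mem_box box_mono card_box add_unitVec_mem_box sub_unitVec_mem_box unitVec_apply_self unitVec_apply_ne)

variable {d : ℕ}

/-! ## §1 Sup-norm shells of `ℤ^d` and the face count in `ℤ³` -/



/-- The sup-norm shell index exists: a function `N : ℤ^d → ℕ` with `y ∈ Q_k(z) ↔ N y ≤ k` for every natural radius `k`
(`N y = max_i |y_i − z_i|`). [folklore] -/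
theorem exists_supIndex (z : Zd d) : ∃ N : Zd d → ℕ, ∀ (y : Zd d) (k : ℕ), y ∈ box z (k : ℤ) ↔ N y ≤ k := by
  refine ⟨fun y => Finset.univ.sup fun i => (y i - z i).natAbs, fun y k => ?_⟩
  rw [mem_box, Finset.sup_le_iff]
  refine forall_congr' fun i => ?_
  simp only [Finset.mem_univ, true_implies]
  rw [← Int.ofNat_le, Int.natCast_natAbs]

/-- Along a bond the shell index moves by at most one. [folklore] -/
theorem supIndex_step {z : Zd d} {N : Zd d → ℕ} (hN : ∀ (y : Zd d) (k : ℕ), y ∈ box z (k : ℤ) ↔ N y ≤ k)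
    (y : Zd d) (μ : Fin d) : N (y + unitVec μ) ≤ N y + 1 ∧ N y ≤ N (y + unitVec μ) + 1 := by
  constructor
  · have h1 : y ∈ box z (N y : ℤ) := (hN y (N y)).2 le_rfl
    have h2 := add_unitVec_mem_box h1 μ
    have : y + unitVec μ ∈ box z ((N y + 1 : ℕ) : ℤ) := by push_cast; exact h2
    exact (hN _ _).1 this
  · have h1 : y + unitVec μ ∈ box z (N (y + unitVec μ) : ℤ) := (hN _ _).2 le_rfl
    have h2 := sub_unitVec_mem_box h1 μ
    rw [add_sub_cancel_right] at h2
    have : y ∈ box z ((N (y + unitVec μ) + 1 : ℕ) : ℤ) := by push_cast; exact h2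
    exact (hN _ _).1 this



/-- On a bond leaving `Q_k(z)` forwards, the source sits on the face `y_μ − z_μ = k`. [folklore] -/
theorem coord_eq_of_mem_of_add_not_mem {z y : Zd 3} {k : ℕ} {μ : Fin 3} (hy : y ∈ box z (k : ℤ))
    (hy' : y + unitVec μ ∉ box z (k : ℤ)) : y μ - z μ = k := by
  rw [mem_box] at hy
  rw [mem_box, not_forall] at hy'
  obtain ⟨i, hi⟩ := hy'
  by_cases hiμ : i = μ
  · subst hiμ
    simp only [Pi.add_apply, unitVec_apply_self] at hi
    have h1 := abs_le.1 (hy i)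
    rw [not_le, lt_abs] at hi
    omega
  · exact absurd (by simpa only [Pi.add_apply, unitVec_apply_ne hiμ, add_zero] using hy i) hi

/-- On a bond entering `Q_k(z)` forwards, the source sits on the face `y_μ − z_μ = −(k+1)`. [folklore] -/
theorem coord_eq_of_not_mem_of_add_mem {z y : Zd 3} {k : ℕ} {μ : Fin 3} (hy : y ∉ box z (k : ℤ))
    (hy' : y + unitVec μ ∈ box z (k : ℤ)) : y μ - z μ = -((k : ℤ) + 1) := by
  rw [mem_box] at hy'
  rw [mem_box, not_forall] at hy
  obtain ⟨i, hi⟩ := hy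
  by_cases hiμ : i = μ
  · subst hiμ
    have h1 := abs_le.1 (hy' i)
    simp only [Pi.add_apply, unitVec_apply_self] at h1
    rw [not_le, lt_abs] at hi
    omega
  · have := hy' i
    simp only [Pi.add_apply, unitVec_apply_ne hiμ, add_zero] at this
    exact absurd this hi

/-- Off the bond direction the coordinates of a crossing bond's source are within `k` of the centre. [folklore] -/
theorem abs_coord_le_of_crossing {z y : Zd 3} {k : ℕ} {μ : Fin 3}
    (h : (y ∈ box z (k : ℤ) ∧ y + unitVec μ ∉ box z (k : ℤ)) ∨ (y ∉ box z (k : ℤ) ∧ y + unitVec μ ∈ box z (k : ℤ)))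
    {i : Fin 3} (hi : i ≠ μ) : |y i - z i| ≤ k := by
  rcases h with ⟨hy, _⟩ | ⟨_, hy'⟩
  · exact (mem_box.1 hy) i
  · have := (mem_box.1 hy') i
    simpa only [Pi.add_apply, unitVec_apply_ne hi, add_zero] using this

/-- ★ Bonds of `Q_{k+1}(z) × {directions}` with exactly one endpoint in `Q_k(z)` (the bonds «crossing the shell `k ↔ k+1`») number at most
`6·(2k+1)²` in `ℤ³`: they sit on the six faces, `(direction, orientation, two transverse coordinates) ∈ 3 × 2 × (2k+1)²`. [folklore] -/
theorem card_crossing_le (z : Zd 3) (k : ℕ) :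
    (((box z ((k : ℤ) + 1)) ×ˢ (Finset.univ : Finset (Fin 3))).filter fun b =>
        (b.1 ∈ box z (k : ℤ) ∧ b.1 + unitVec b.2 ∉ box z (k : ℤ)) ∨
          (b.1 ∉ box z (k : ℤ) ∧ b.1 + unitVec b.2 ∈ box z (k : ℤ))).card ≤ 6 * (2 * k + 1) ^ 2 := by
  classical
  set D : Finset (Fin 3 × Bool × (Fin 2 → ℤ)) :=
    (Finset.univ : Finset (Fin 3)) ×ˢ ((Finset.univ : Finset Bool) ×ˢ
      (Fintype.piFinset fun _ : Fin 2 => Finset.Icc (-(k : ℤ)) (k : ℤ))) with hD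
  have hDcard : D.card = 6 * (2 * k + 1) ^ 2 := by
    rw [hD, Finset.card_product, Finset.card_product, Fintype.card_piFinset, Finset.card_univ, Finset.card_univ,
      Fintype.card_fin, Fintype.card_bool]
    simp only [Int.card_Icc, Finset.prod_const, Finset.card_univ, Fintype.card_fin]
    have : ((k : ℤ) + 1 - -(k : ℤ)).toNat = 2 * k + 1 := by omega
    rw [this]; ring
  rw [← hDcard]
  refine Finset.card_le_card_of_injOn
    (fun b => (b.2, decide (b.1 ∈ box z (k : ℤ)), fun j => b.1 (b.2.succAbove j) - z (b.2.succAbove j))) ?_ ?_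
  · intro b hb
    rw [Finset.mem_coe, Finset.mem_filter] at hb
    rw [hD, Finset.mem_coe, Finset.mem_product, Finset.mem_product, Fintype.mem_piFinset]
    refine ⟨Finset.mem_univ _, Finset.mem_univ _, fun j => ?_⟩
    rw [Finset.mem_Icc, ← abs_le]
    exact abs_coord_le_of_crossing hb.2 (Fin.succAbove_ne _ _)
  · intro b hb b' hb' h
    rw [Finset.mem_coe, Finset.mem_filter] at hb hb'
    simp only [Prod.mk.injEq] at h
    obtain ⟨hμ, hdec, hfun⟩ := h
    -- same direction
    have hμ' : b'.2 = b.2 := hμ.symm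
    -- the bond-direction coordinate is forced by the orientation
    have hcoord : b.1 b.2 = b'.1 b.2 := by
      rcases hb.2 with ⟨hy, hy'⟩ | ⟨hy, hy'⟩
      · have h1 := coord_eq_of_mem_of_add_not_mem hy hy'
        have hin' : b'.1 ∈ box z (k : ℤ) := by
          have := decide_eq_true hy
          rw [this] at hdec
          exact of_decide_eq_true hdec.symm
        rcases hb'.2 with ⟨hz, hz'⟩ | ⟨hz, _⟩
        · have h2 := coord_eq_of_mem_of_add_not_mem hz hz'
          rw [hμ'] at h2
          omega
        · exact absurd hin' hz
      · have h1 := coord_eq_of_not_mem_of_add_mem hy hy'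
        have hout' : b'.1 ∉ box z (k : ℤ) := by
          intro hin'
          have := decide_eq_true hin'
          rw [this] at hdec
          exact hy (of_decide_eq_true hdec)
        rcases hb'.2 with ⟨hz, _⟩ | ⟨hz, hz'⟩
        · exact absurd hz hout'
        · have h2 := coord_eq_of_not_mem_of_add_mem hz hz'
          rw [hμ'] at h2
          omega
    -- all coordinates agree
    have hpt : b.1 = b'.1 := by
      funext i
      by_cases hi : i = b.2
      · rw [hi]; exact hcoord
      · obtain ⟨j, hj⟩ := Fin.exists_succAbove_eq hi
        have := congr_fun hfun j
        rw [hμ'] at this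
        rw [hj] at this
        omega
    exact Prod.ext hpt hμ


/-! ## §2 The sup-norm log profile (Hardy-optimal radial weight, truncated and tapered) -/

/-- An elementary square-root increment bound: for `0 < b ≤ a`, `(a − b)² ≤ (a² − b²)²∕(4b²)`. [folklore] -/
theorem sq_sub_le_of_sq {a b : ℝ} (hb : 0 < b) (hab : b ≤ a) : (a - b) ^ 2 ≤ (a ^ 2 - b ^ 2) ^ 2 / (4 * b ^ 2) := by
  rw [le_div_iff₀ (by positivity)]
  have h1 : 0 ≤ (a - b) ^ 3 * (a + 3 * b) := mul_nonneg (pow_nonneg (by linarith) 3) (by linarith)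
  nlinarith [h1]

/-- ★ **THE SUP-NORM LOG PROFILE** (existence, def-free): for `1 ≤ r ≤ M` there is `f : ℕ → ℝ`, `f ≡ 1` on `[0, r]`, `f(n) = √(r∕n)` on `[r, M]`,
linear taper `√(r∕M)·(2M − n)∕M` on `[M, 2M]`, `f ≡ 0` beyond `2M`; it is `[0,1]`-valued, non-increasing, with the HARDY increments
`(f(k) − f(k+1))² ≤ r∕(4k²(k+1))` and the exact telescoping `f(k)² − f(k+1)² = r∕k − r∕(k+1)` on the log range, and taper increments `r∕M³`. [folklore] -/
theorem exists_logProfile (r M : ℕ) (hr : 1 ≤ r) (hrM : r ≤ M) : ∃ f : ℕ → ℝ,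
    (∀ n, 0 ≤ f n) ∧ (∀ n, f n ≤ 1) ∧ (∀ n, f (n + 1) ≤ f n) ∧ (∀ n, 2 * M ≤ n → f n = 0) ∧ (∀ n, n ≤ r → f n = 1) ∧
    (∀ k, r ≤ k → k < M → f k ^ 2 - f (k + 1) ^ 2 = (r : ℝ) / k - (r : ℝ) / (k + 1)) ∧
    (∀ k, r ≤ k → k < M → (f k - f (k + 1)) ^ 2 ≤ (r : ℝ) / (4 * (k : ℝ) ^ 2 * (k + 1))) ∧
    (∀ k, M ≤ k → k < 2 * M → (f k - f (k + 1)) ^ 2 ≤ (r : ℝ) / (M : ℝ) ^ 3) := by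
  have hr0 : (0 : ℝ) < r := by exact_mod_cast hr
  have hM0 : (0 : ℝ) < M := by exact_mod_cast (lt_of_lt_of_le hr hrM)
  have hM1 : 1 ≤ M := le_trans hr hrM
  set f : ℕ → ℝ := fun n => if n ≤ r then 1 else if n ≤ M then Real.sqrt ((r : ℝ) / n)
    else if n ≤ 2 * M then Real.sqrt ((r : ℝ) / M) * ((2 * (M : ℝ) - n) / M) else 0 with hf
  -- closed forms on the three ranges
  have hlog : ∀ n, r ≤ n → n ≤ M → f n = Real.sqrt ((r : ℝ) / n) := by
    intro n h1 h2
    by_cases h : n ≤ r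
    · have hnr : n = r := le_antisymm h h1
      simp only [hf]
      rw [if_pos h, hnr, div_self hr0.ne', Real.sqrt_one]
    · simp only [hf]
      rw [if_neg h, if_pos h2]
  have htap : ∀ n, M ≤ n → n ≤ 2 * M → f n = Real.sqrt ((r : ℝ) / M) * ((2 * (M : ℝ) - n) / M) := by
    intro n h1 h2
    have htwo : (2 * (M : ℝ) - M) / M = 1 := by
      rw [div_eq_one_iff_eq hM0.ne']; ring
    by_cases h : n ≤ M
    · have hnM : n = M := le_antisymm h h1
      by_cases hn : n ≤ r
      · have hrM' : (r : ℝ) = M := by exact_mod_cast (le_antisymm hrM (hnM ▸ hn))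
        simp only [hf]
        rw [if_pos hn, hnM, htwo, mul_one, hrM', div_self hM0.ne', Real.sqrt_one]
      · simp only [hf]
        rw [if_neg hn, if_pos h, hnM, htwo, mul_one]
    · have hn : ¬ n ≤ r := by omega
      simp only [hf]
      rw [if_neg hn, if_neg h, if_pos h2]
  have hzero : ∀ n, 2 * M ≤ n → f n = 0 := by
    intro n h
    by_cases h2 : n ≤ 2 * M
    · have : n = 2 * M := le_antisymm h2 h
      rw [htap n (by omega) h2, this]
      push_cast
      ring
    · have hn : ¬ n ≤ r := by omega
      have hn' : ¬ n ≤ M := by omega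
      simp only [hf]
      rw [if_neg hn, if_neg hn', if_neg h2]
  have hone : ∀ n, n ≤ r → f n = 1 := fun n h => by
    simp only [hf]
    rw [if_pos h]
  have hsqrt_le_one : ∀ n, r ≤ n → Real.sqrt ((r : ℝ) / n) ≤ 1 := by
    intro n h
    rw [Real.sqrt_le_one]
    have hn0 : (0 : ℝ) < n := by exact_mod_cast (lt_of_lt_of_le hr h)
    rw [div_le_one hn0]
    exact_mod_cast h
  have hnonneg : ∀ n, 0 ≤ f n := by
    intro n
    by_cases h1 : n ≤ r
    · rw [hone n h1]; exact zero_le_one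
    by_cases h2 : n ≤ M
    · rw [hlog n (by omega) h2]; exact Real.sqrt_nonneg _
    by_cases h3 : n ≤ 2 * M
    · rw [htap n (by omega) h3]
      refine mul_nonneg (Real.sqrt_nonneg _) (div_nonneg ?_ hM0.le)
      have : (n : ℝ) ≤ 2 * M := by exact_mod_cast h3
      linarith
    · rw [hzero n (by omega)]
  have hle_one : ∀ n, f n ≤ 1 := by
    intro n
    by_cases h1 : n ≤ r
    · rw [hone n h1]
    by_cases h2 : n ≤ M
    · rw [hlog n (by omega) h2]; exact hsqrt_le_one n (by omega)
    by_cases h3 : n ≤ 2 * M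
    · rw [htap n (by omega) h3]
      have ha : Real.sqrt ((r : ℝ) / M) ≤ 1 := hsqrt_le_one M hrM
      have hb : (2 * (M : ℝ) - n) / M ≤ 1 := by
        rw [div_le_one hM0]
        have : (M : ℝ) < n := by exact_mod_cast (not_le.mp h2)
        linarith
      have hb0 : 0 ≤ (2 * (M : ℝ) - n) / M := by
        refine div_nonneg ?_ hM0.le
        have : (n : ℝ) ≤ 2 * M := by exact_mod_cast h3
        linarith
      calc Real.sqrt ((r : ℝ) / M) * ((2 * (M : ℝ) - n) / M) ≤ 1 * 1 := mul_le_mul ha hb hb0 zero_le_one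
        _ = 1 := one_mul 1
    · rw [hzero n (by omega)]; exact zero_le_one
  have hstep : ∀ n, f (n + 1) ≤ f n := by
    intro n
    by_cases h1 : n + 1 ≤ r
    · rw [hone n (by omega), hone (n + 1) h1]
    by_cases h1' : n ≤ r
    · rw [hone n h1']; exact hle_one _
    -- now `r < n`
    by_cases h2 : n + 1 ≤ M
    · rw [hlog n (by omega) (by omega), hlog (n + 1) (by omega) h2]
      have hn0 : (0 : ℝ) < n := by exact_mod_cast (show 0 < n by omega)
      refine Real.sqrt_le_sqrt (div_le_div_of_nonneg_left hr0.le hn0 ?_)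
      push_cast; linarith
    by_cases h2' : n ≤ M
    · -- `n = M`
      have hnM : n = M := by omega
      by_cases h3 : n + 1 ≤ 2 * M
      · rw [hlog n (by omega) h2', htap (n + 1) (by omega) h3, hnM]
        have hb : (2 * (M : ℝ) - (M + 1 : ℕ)) / M ≤ 1 := by
          rw [div_le_one hM0]; push_cast; linarith
        calc Real.sqrt ((r : ℝ) / M) * ((2 * (M : ℝ) - (M + 1 : ℕ)) / M) ≤ Real.sqrt ((r : ℝ) / M) * 1 :=
              mul_le_mul_of_nonneg_left hb (Real.sqrt_nonneg _)
          _ = Real.sqrt ((r : ℝ) / M) := mul_one _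
      · rw [hzero (n + 1) (by omega)]; exact hnonneg _
    -- now `M < n`
    by_cases h3 : n + 1 ≤ 2 * M
    · rw [htap n (by omega) (by omega), htap (n + 1) (by omega) h3]
      refine mul_le_mul_of_nonneg_left (div_le_div_of_nonneg_right ?_ hM0.le) (Real.sqrt_nonneg _)
      push_cast; linarith
    · rw [hzero (n + 1) (by omega)]; exact hnonneg _
  refine ⟨f, hnonneg, hle_one, hstep, hzero, hone, ?_, ?_, ?_⟩
  · -- exact telescoping of squares on the log range
    intro k hk1 hk2
    have hk0 : (0 : ℝ) < k := by exact_mod_cast (lt_of_lt_of_le hr hk1)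
    rw [hlog k hk1 hk2.le, hlog (k + 1) (by omega) (by omega),
      Real.sq_sqrt (div_nonneg hr0.le hk0.le), Real.sq_sqrt (div_nonneg hr0.le (by positivity))]
    push_cast
    ring
  · -- Hardy increments on the log range
    intro k hk1 hk2
    have hk0 : (0 : ℝ) < k := by exact_mod_cast (lt_of_lt_of_le hr hk1)
    rw [hlog k hk1 hk2.le, hlog (k + 1) (by omega) (by omega)]
    set a := Real.sqrt ((r : ℝ) / k) with ha
    set b := Real.sqrt ((r : ℝ) / (k + 1 : ℕ)) with hb
    have hb0 : 0 < b := Real.sqrt_pos.2 (by positivity)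
    have hab : b ≤ a := Real.sqrt_le_sqrt (div_le_div_of_nonneg_left hr0.le hk0 (by push_cast; linarith))
    have ha2 : a ^ 2 = (r : ℝ) / k := Real.sq_sqrt (div_nonneg hr0.le hk0.le)
    have hb2 : b ^ 2 = (r : ℝ) / (k + 1) := by
      rw [hb, Real.sq_sqrt (by positivity)]; push_cast; ring
    calc (a - b) ^ 2 ≤ (a ^ 2 - b ^ 2) ^ 2 / (4 * b ^ 2) := sq_sub_le_of_sq hb0 hab
      _ = (r : ℝ) / (4 * (k : ℝ) ^ 2 * (k + 1)) := by
          rw [ha2, hb2]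
          field_simp
          ring
  · -- taper increments
    intro k hk1 hk2
    rw [htap k hk1 (by omega), htap (k + 1) (by omega) (by omega)]
    have : Real.sqrt ((r : ℝ) / M) * ((2 * (M : ℝ) - k) / M) - Real.sqrt ((r : ℝ) / M) * ((2 * (M : ℝ) - (k + 1 : ℕ)) / M) =
        Real.sqrt ((r : ℝ) / M) / M := by
      push_cast
      field_simp
      ring
    rw [this, div_pow, Real.sq_sqrt (div_nonneg hr0.le hM0.le), div_div, ← pow_succ']

end Summit.QuantumFields.YangMills.Theorems.PoincareLipschitzLogCutoffLetters
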